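/-
Origin: expansion seat `planner-pub-hodgecm-pv09-g3-0`, handover 2026-08-18T06:06:05Z (`HOME/pub-hodgecm-pv09-g3/lean/Pv09g3/HaarVolume.lean`, md5 7ce0797f, 146 lines);
landed by the gen-6 packager in gate run 24 as `HodgeCM/PerL34/HaarVolume.lean` (import ^import Pv[0-9]+g[0-9]+\.→import HodgeCM.PerL34. ×1).
-/
/-
Copyright: HodgeCM publication cell (pub-hodgecm), DAG node N31 — seam S3 / seam (I) (prover pv09, gen 3).
Released under the package licence.

# The Haar datum's global measure IS a Haar measure; the volume hypotheses from compactness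

Source under adjudication (NOT cited as a fact; this file PROVES a typed piece of it):
PerL v5 = `inputs/2001/summits__hodge-w-picard-modular-quadrilinear-period-galois-
closure__free__y1__paper__paper.tex`, Lemma 4.2(b), tex l. 611/631 (`vol([U(W_i)])` is a finite
positive number: `U(W_i)` is anisotropic, `[U(W_i)] = U(W_i)(F)\U(W_i)(𝔸_F)` is compact).

## What this file does

* `isHaarMeasure_haarDatum_μ` (instance): the measure `(haarDatum B hBc hBo S₀).μ` on `Πʳ_i [G_i, B_i]`
  is a HAAR MEASURE in Mathlib's sense (pv09-g2 `RestrictedMeasure.isHaarMeasure_rpMeasure`, LANDED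
  run 22, specialised to the Haar datum of item 10);
* `haarDatum_vol_ne_zero` : `(interior 𝓕).Nonempty → μ 𝓕 ≠ 0`; `haarDatum_vol_ne_top` :
  `IsCompact 𝓕 → μ 𝓕 ≠ ⊤`;
* **`haarPiecesCpt`**, `haarPiecesCpt_I`, **`rallis_haarCpt`**, **`theta_ne_zero_haarCpt`** : item 10's
  `haarPieces` / `rallis_haar` / `theta_ne_zero_haar` with the two volume hypotheses replaced by
  `IsCompact 𝓕` and `(interior 𝓕).Nonempty` (a compact fundamental domain with non-empty interior for
  the compact quotient `[U(W_i)]`); `theta_ne_zero_haarCpt_of_places` : moreover `summable_t`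
  discharged by pv13's `EulerProduct.summable_tOf_of_places` when the indices outside `S` are finite
  places of a number field with `q_j = N(v_j)` — the END FORM of seam S3 for the canonical data.
Nothing is cited; no hypothesis names PerL, QW8 or a 2001-programme claim.  Imports: item 10.
Axioms = the standard trio.
Unit `pub-hodgecm-pv09-g3` (DAG-node prover #09, generation 3), 2026-08-18.
-/
import Summits.HodgeConjecture.HodgeCM.PerL34.HaarPieces

/-! PORT of `HodgeCM/PerL34/HaarVolume.lean` (HodgeCMPerL run 82) — verbatim mechanical port; provenance in the PORT header line. -/

set_option autoImplicit false

noncomputable section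

open MeasureTheory Set Filter Function Topology Complex ComplexConjugate

open scoped RestrictedProduct InnerProductSpace

namespace HodgeCM.PerL34.PureTensor

open HodgeCM.PerL34.AdelicFactorisation HodgeCM.PerL34.RestrictedMeasure
  HodgeCM.PerL34.NoSmallSubgroups HodgeCM.PerL34.EulerFactorisation

section haarMeasure

variable {ι : Type} {G : ι → Type} [∀ i, CommGroup (G i)] [∀ i, TopologicalSpace (G i)]
  [∀ i, IsTopologicalGroup (G i)] [∀ i, T2Space (G i)] [∀ i, SecondCountableTopology (G i)]
  [∀ i, LocallyCompactSpace (G i)] [∀ i, MeasurableSpace (G i)] [∀ i, BorelSpace (G i)]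
  [Countable ι]
  (B : ∀ i, Subgroup (G i)) (hBc : ∀ i, IsCompact (B i : Set (G i)))
  (hBo : ∀ i, IsOpen (B i : Set (G i))) (S₀ : Finset ι)

/-- **The global measure of the Haar datum is a Haar measure** on the locally compact group
`Πʳ_i [G_i, B_i]` (pv09-g2's Haar theorem for restricted product measures). -/
instance isHaarMeasure_haarDatum_μ : ((haarDatum B hBc hBo S₀).μ).IsHaarMeasure := by
  haveI : Fact (∀ i, IsOpen (B i : Set (G i))) := ⟨hBo⟩
  exact RestrictedMeasure.isHaarMeasure_rpMeasure B S₀ (posCompacts B hBc hBo)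
    (fun i => Measure.haarMeasure (posCompacts B hBc hBo i)) (fun i _ => hBc i)
    (fun i _ => haarDatum_ν_self B hBc hBo S₀ i)

omit [∀ i, LocallyCompactSpace (G i)] in
/-- A set with non-empty interior has positive volume for the Haar datum. -/
theorem haarDatum_vol_ne_zero {𝓕 : Set (Πʳ j, [G j, B j])} (h𝓕 : (interior 𝓕).Nonempty) :
    (haarDatum B hBc hBo S₀).μ 𝓕 ≠ 0 :=
  (Measure.measure_pos_of_nonempty_interior _ h𝓕).ne'

omit [∀ i, LocallyCompactSpace (G i)] in
/-- A compact set has finite volume for the Haar datum. -/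
theorem haarDatum_vol_ne_top {𝓕 : Set (Πʳ j, [G j, B j])} (h𝓕 : IsCompact 𝓕) :
    (haarDatum B hBc hBo S₀).μ 𝓕 ≠ ⊤ :=
  h𝓕.measure_lt_top.ne

end haarMeasure

section haarCpt

variable {ι : Type} {G : ι → Type} [∀ i, CommGroup (G i)] [∀ i, TopologicalSpace (G i)]
  [∀ i, IsTopologicalGroup (G i)] [∀ i, T2Space (G i)] [∀ i, SecondCountableTopology (G i)]
  [∀ i, LocallyCompactSpace (G i)] [∀ i, MeasurableSpace (G i)] [∀ i, BorelSpace (G i)]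
  [Countable ι] [DecidableEq ι]
  (B : ∀ i, Subgroup (G i)) (hBc : ∀ i, IsCompact (B i : Set (G i)))
  (hBo : ∀ i, IsOpen (B i : Set (G i))) (S₀ : Finset ι)
  {Sp : Type} [NormedAddCommGroup Sp] [InnerProductSpace ℂ Sp]
  {E : Type*} [NormedAddCommGroup E] [InnerProductSpace ℂ E]
  (ω : (Πʳ j, [G j, B j]) →* (Sp ≃ₗᵢ[ℂ] Sp)) (φ : Sp) (hφ : ‖φ‖ = 1)
  (hω : Continuous fun y => ω y φ)
  (χ : (Πʳ j, [G j, B j]) →* Circle) (hχ : Continuous χ)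
  (𝓕 : Set (Πʳ j, [G j, B j])) (h𝓕c : IsCompact 𝓕) (h𝓕i : (interior 𝓕).Nonempty)
  (K : (Πʳ j, [G j, B j]) → (Πʳ j, [G j, B j]) → ℂ) (c : ℝ) (c_pos : 0 < c) (θ : E) (Θ : Set E)
  (hθ : θ ∈ Θ)
  (hN31e : RallisIP.N31e_statement (haarDatum B hBc hBo S₀).μ 𝓕 ω φ
    (fun y => ((χ y : Circle) : ℂ)) K (c : ℂ))
  (hnorm : ⟪θ, θ⟫_ℂ = ∫ u in 𝓕, ∫ u' in 𝓕, ((χ u : Circle) : ℂ) * conj ((χ u' : Circle) : ℂ) *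
    K u u' ∂(haarDatum B hBc hBo S₀).μ ∂(haarDatum B hBc hBo S₀).μ)
  {T T' : Finset ι} (hK : ∀ k ∈ RestrictedProduct.boxSubgroup B T, ω k φ = φ)
  (hχT' : RestrictedProduct.boxSubgroup B T' ≤ χ.ker)
  (hM : ∀ S : Finset ι, T ⊆ S → ∀ y : (i : ↥S) → G i,
    inner ℂ φ (ω (extendOne B S y) φ) = ∏ i : ↥S, localCoeff B ω φ i (y i))
  {S : Finset ι} {q : ι → ℕ} {chiPi nuPi : ι → ℂ} {IsSplit : ι → Prop}
  (X : UnramifiedPlaceData B (haarDatum B hBc hBo S₀) ω φ χ S q chiPi nuPi IsSplit)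
  (hTS : T ⊆ S) (hT'S : T' ⊆ S)
  (hclS : ∀ i ∈ S, Integrable (localCoeff B ω φ i) ((haarDatum B hBc hBo S₀).ν i))
  (ram_pos : ∀ i ∈ S, 0 < (localIntegrand B (haarDatum B hBc hBo S₀) ω φ χ i).I)
  (hsum : Summable fun i : {j : ι // j ∉ S} => EulerProduct.tOf (q i.1))

include hφ hω hχ h𝓕c h𝓕i c_pos hθ hN31e hnorm hK hχT' hM X hTS hT'S hclS ram_pos hsum

/-- **The canonical pieces over the Haar datum, compact fundamental domain.** -/
def haarPiecesCpt : LocalFactorPieces ι E :=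
  haarPieces B hBc hBo S₀ ω φ hφ hω χ hχ 𝓕 K c c_pos (haarDatum_vol_ne_zero B hBc hBo S₀ h𝓕i)
    (haarDatum_vol_ne_top B hBc hBo S₀ h𝓕c) θ Θ hθ hN31e hnorm hK hχT' hM X hTS hT'S hclS ram_pos
    hsum

/-- (Ported verbatim from the HodgeCMPerL package; no docstring in the source.) -/
theorem haarPiecesCpt_I (i : ι) :
    (haarPiecesCpt B hBc hBo S₀ ω φ hφ hω χ hχ 𝓕 h𝓕c h𝓕i K c c_pos θ Θ hθ hN31e hnorm hK hχT' hM X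
      hTS hT'S hclS ram_pos hsum).I i = (localIntegrand B (haarDatum B hBc hBo S₀) ω φ χ i).I :=
  rfl

/-- **Rallis over the Haar datum, compact fundamental domain.** -/
theorem rallis_haarCpt :
    RCLike.re ⟪θ, θ⟫_ℂ = c * ((haarDatum B hBc hBo S₀).μ 𝓕).toReal *
      ∏' i, (localIntegrand B (haarDatum B hBc hBo S₀) ω φ χ i).I :=
  (haarPiecesCpt B hBc hBo S₀ ω φ hφ hω χ hχ 𝓕 h𝓕c h𝓕i K c c_pos θ Θ hθ hN31e hnorm hK hχT' hM X
    hTS hT'S hclS ram_pos hsum).rallis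

/-- **N31h over the Haar datum, compact fundamental domain**: `θ ≠ 0`. -/
theorem theta_ne_zero_haarCpt : θ ≠ 0 :=
  (haarPiecesCpt B hBc hBo S₀ ω φ hφ hω χ hχ 𝓕 h𝓕c h𝓕i K c c_pos θ Θ hθ hN31e hnorm hK hχT' hM X
    hTS hT'S hclS ram_pos hsum).toLocalFactorDatum.theta_ne_zero

omit hsum in
/-- **Number-field places, end form of seam S3 for the canonical data**: if the places outside `S`
are (injectively) finite places `v_j` of a number field `L₀` with `q_j = N(v_j)`, pv13's
`EulerProduct.summable_tOf_of_places` discharges `summable_t`, and `θ ≠ 0`. -/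
theorem theta_ne_zero_haarCpt_of_places (L₀ : Type*) [Field L₀] [NumberField L₀]
    (e : {j : ι // j ∉ S} → IsDedekindDomain.HeightOneSpectrum (NumberField.RingOfIntegers L₀))
    (he : Function.Injective e)
    (hq : ∀ j : {j : ι // j ∉ S}, q j.1 = Ideal.absNorm (e j).asIdeal) : θ ≠ 0 :=
  theta_ne_zero_haarCpt B hBc hBo S₀ ω φ hφ hω χ hχ 𝓕 h𝓕c h𝓕i K c c_pos θ Θ hθ hN31e hnorm hK hχT'
    hM X hTS hT'S hclS ram_pos (EulerProduct.summable_tOf_of_places L₀ e he hq)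

end haarCpt

end HodgeCM.PerL34.PureTensor

end
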